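import Summits.Langlands.Langlands.Theses.SolvableReachSplit

/-!
# Glue of the layer-2 split of `SolvableReach` (route SolvableReachSplit, rev 1)

Closes the glue item `stmt-Langlands-30115` of `route-Langlands-SolvableReachSplit`:
`SolvableReach_of_pieces : SolDoorReach → ProjectivelyLargeReach → SolvableReach`.
Pure logic — a case split on «n = 2 ∧ the family has a solvable-point DOOR»
(`Summit.Langlands.Langlands.Theorems.SatakeFamilyReach.SolDoor a`): the door case is `SolDoorReach`
(SDR, rank 2), the complement is `ProjectivelyLargeReach` (PLR).  The parent states the Satake-family
vocabulary inline while the children are written over the landed definitions module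
`Theorems/SatakeFamilyReach.lean`; the two readings agree by definitional unfolding (lens-3-g6
`solvableReach_iff_module := Iff.rfl`), so `exact` closes each case.  Proof = the writer's ready-to-land
file nodes/writer-1-g2-SolvableReachSplit-step2.glue_proof.lean (decomp-langlands, 2026-08-30),
transported with docstrings.  No definitions, no new mathematics.
-/

set_option linter.dupNamespace false -- project-wide option; `Summit.Langlands.Langlands` is the mandated namespace

namespace Summit.Langlands.Langlands.Theorems

open Summit.Langlands.Langlands.Theses in
/-- The glue item `stmt-Langlands-30115` of route SolvableReachSplit (rev 1): the two children
`SolDoorReach` (SDR) and `ProjectivelyLargeReach` (PLR) of the split of `SolvableReach` (SR) imply the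
parent.  Proof: by cases on `n = 2 ∧ SolDoor a`; in the door case substitute `n = 2` and apply SDR, in
the other case apply PLR with the curried negation. -/
theorem SolvableReach_of_pieces_proof :
    Summit.Langlands.Langlands.Theses.SolvableReachSplit.SolvableReach_of_pieces := by
  intro hD hP K _ _ n hcpt hn a ha
  by_cases h : n = 2 ∧ Summit.Langlands.Langlands.Theorems.SatakeFamilyReach.SolDoor a
  · obtain ⟨rfl, hd⟩ := h
    exact hD K hcpt a ha hd
  · exact hP K n hcpt hn a ha (fun hn2 hd => h ⟨hn2, hd⟩)

end Summit.Langlands.Langlands.Theorems
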